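import Literature.Probability.LatticeModels.PolymerGasGeometric

/-!
# `BalabanImbrieJaffe1984to88.BIJ88ComponentResum320` — T. Bałaban, J. Imbrie, A. Jaffe, *Effective action and cluster
properties of the abelian Higgs model*, Commun. Math. Phys. **114** (1988) 257–315 [BalabanImbrieJaffe1988]: the REGROUPING
IDENTITY behind (3.20)–(3.22), p. 268 — a sum over the expansion sets `S_π`, `S_p` regrouped by the connected components
`{X_ω}` of the region they generate — PROVED as the finite combinatorial identity it is, over an arbitrary finite set of cubes
with a symmetric adjacency

statement-level skeleton of published theorems with citation tags; proofs where landed; nothing here is a claim about the Yang–Mills mass gap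

PDF held: `paper:balaban1988-cmp114-bij-abelian-higgs-effective-action` (journal page = PDF page + 256).  Render read as an
image: PDF p. 12 (journal 268), `HOME/lit-balaban-r16/renders/cmp114/original-p012-x2.png`.

CITATION HEADER (lean-in-tree rule).  Part of the lit-balaban TYPED SKELETON (HOME `run/shared/lean/pub/lit-balaban/`; rows
`C2.Eq3.20` and `C2.Eq3.22` of `HOME/lit-balaban-r18/ROWS-C2.md`; unit `lit-balaban-r18`, gen 6; file 1 of 2, file 2 =
`BIJ88Eq322Identity` assembling (3.14)–(3.22) for the model).  WHAT IS REPRODUCED, verbatim, p. 268 [PDF 12]: *"We group together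
large-field regions and regions with irrelevant terms. Anticipating the structure of the induction, we define Λ₁₃^{(−1)c} as the
union of r(e₀)-cubes covering Λ₀^{(0)c} and all plaquettes in S_p or S_π. We divide Λ₁₃^{(−1)c} into connected components {X_ω},
and define g₀(X_ω) = Σ_{S_π ⊂ π(F)∩Λ₀^{(0)**}∩X_ω^{**}} Σ_{S_p ⊂ Λ₀^{(0)**}∩X_ω^{**}} Π_{p∈S_π} F_irr(p) Π_{p∈S_π^c∩X_ω^{**}} F_rel(p)
… Π_{p∈S_p}(e^{−W₀(p)} − 1) × exp[…]. (3.20) … The remaining r(e₀)-cubes covering the support of F are divided into connected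
components {X_σ}, and we put F_{0,loc}(X_σ) = … (3.21) Our density now takes the following form: ρ₁^L(v, ψ) = Σ_{Λ₀^{(0)}} Σ_{{X_ω}}
∫ … Π_ω g₀(X_ω) Π_σ F_{0,loc}(X_σ) exp[…], (3.22)"*.

TYPED READING (the combinatorics only; the model enters in file 2).  CUBES: a finite type `κ` with a symmetric adjacency
`R` (the r(e₀)-cubes of `T₁` and "touching"); connectedness, components and compatible ("hard-core", pairwise non-touching)
families are those of the tree's `Literature.Probability.LatticeModels.PolymerGasGeometric` (`IsRConnected`, `rcomponents`,
`IsCompatible (GeomInc R)`), the finite set of all such families is `gases R`.  ITEMS: a finite set `items : Finset E` of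
expandable factors (the plaquettes of `π(F) ∩ Λ₀**` and of `Λ₀**`), each with a HOME cube `home : E → κ` (reading of record of
*"r(e₀)-cubes covering … all plaquettes in S_p or S_π"*: one cube per plaquette) and two values `w₁ e` (selected: `F_irr(p)`,
`e^{−W₀(p)} − 1`) and `w₀ e` (not selected: `F_rel(p)`, `1`); a FIXED cube set `D` (the cubes of `Λ₀^{(0)c}`); per-cube factors
`k c` inside the generated region (the exponential of (3.20) and the unexpanded factors of `F` homed at `c`) and `h c` outside it
(the factors of (3.21)).  One term of the expanded sum is `wt w₁ w₀ items S · Π_{c ∈ region} k c · Π_{c ∉ region} h c` with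
`region D home S = D ∪ home(S)` (= `Λ₁₃^{(−1)c}`), and the activity of a connected set `X` is
`gfun … D k X = Σ_{S_X ⊆ items homed in X, (D ∩ X) ∪ home(S_X) = X} wt … S_X · Π_{c∈X} k c` — this is **(3.20) with the implicit
constraint made explicit**: the inner sums of `g₀(X_ω)` range over those `S_π`, `S_p` inside `X_ω` which, together with the part of
`Λ₀^{(0)c}` inside `X_ω`, GENERATE `X_ω` (reading note GAPS G-C2-09 of `HOME/GAPS.md`; without the constraint the double sum
over `{X_ω}` and `S` would overcount).
PROVED (kernel-checked, 0 sorry, no `Prop`-valued definition): `resum320` —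
`Σ_{S ⊆ items} wt S · Π_{c∈region S} k c · Π_{c∉region S} h c
   = Σ_{𝒢 ∈ gases R, D ⊆ ⋃𝒢} (Π_{X∈𝒢} gfun X) · Π_{c ∉ ⋃𝒢} (h c · Π_{e ∈ items, home e = c} w₀ e)`,
i.e. *"Σ_{S_π} Σ_{S_p} (…) = Σ_{{X_ω}} Π_ω g₀(X_ω) Π_σ F_{0,loc}(X_σ)"* (the complement product grouped into the components
`{X_σ}` of the complement: `resum320_components`, `prod_eq_prod_rcomponents`); its ingredients: subsets of a disjoint union as pairs
(`sum_powerset_union_of_disjoint`), subsets of the cube set ↔ compatible families of connected sets via `rcomponents`/`⋃`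
(`sum_powerset_univ_eq_sum_gases`, from the tree's `rcomponents_biUnion_eq`/`biUnion_rcomponents`), and the factorisation of the
constrained fiber sum over pairwise disjoint regions (`fiber_sum_eq_prod_gfun`).  Valid in every commutative ring `M` (file 2 uses
`M = ℂ` pointwise in the fields).  NOT HERE: any bound; the model's factors (file 2).
-/

namespace Literature.MathematicalPhysics.QuantumFieldTheory.BalabanImbrieJaffe1984to88.BIJ88ComponentResum320

open Finset
open Literature.Probability.LatticeModels

section PowersetUnion

variable {E M : Type*} [DecidableEq E] [AddCommMonoid M]

/-- Subsets of a disjoint union `A ∪ B` are the pairs (subset of `A`, subset of `B`): `Σ_{S ⊆ A∪B} F(S) = Σ_{S₁⊆A} Σ_{S₂⊆B} F(S₁ ∪ S₂)`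
(used for `S = S_π ⊔ S_p` and for splitting `S` along the components `X_ω`). [cite: BalabanImbrieJaffe1988, (3.20) p.268] -/
theorem sum_powerset_union_of_disjoint {A B : Finset E} (hAB : Disjoint A B) (F : Finset E → M) :
    ∑ S ∈ (A ∪ B).powerset, F S = ∑ S₁ ∈ A.powerset, ∑ S₂ ∈ B.powerset, F (S₁ ∪ S₂) := by
  rw [← Finset.sum_product']
  symm
  refine Finset.sum_nbij' (fun p => p.1 ∪ p.2) (fun S => (S ∩ A, S ∩ B)) ?_ ?_ ?_ ?_ ?_
  · intro p hp
    rw [mem_product, mem_powerset, mem_powerset] at hp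
    exact mem_powerset.2 (union_subset_union hp.1 hp.2)
  · intro S hS
    rw [mem_product, mem_powerset, mem_powerset]
    exact ⟨inter_subset_right, inter_subset_right⟩
  · intro p hp
    rw [mem_product, mem_powerset, mem_powerset] at hp
    have h1 : (p.1 ∪ p.2) ∩ A = p.1 := by
      rw [union_inter_distrib_right, inter_eq_left.2 hp.1, disjoint_iff_inter_eq_empty.1 (hAB.symm.mono_left hp.2),
        union_empty]
    have h2 : (p.1 ∪ p.2) ∩ B = p.2 := by
      rw [union_inter_distrib_right, inter_eq_left.2 hp.2, disjoint_iff_inter_eq_empty.1 (hAB.mono_left hp.1),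
        empty_union]
    exact Prod.ext h1 h2
  · intro S hS
    rw [mem_powerset] at hS
    show S ∩ A ∪ S ∩ B = S
    rw [← inter_union_distrib_left, inter_eq_left.2 hS]
  · intro p _
    rfl

end PowersetUnion


/-! ## Gases: compatible families of connected cube sets, and the re-indexing subsets ↔ gases -/

section Gases

variable {κ : Type*} [DecidableEq κ] [Fintype κ] (R : κ → κ → Prop)

/-- The finite set of all *families `{X_ω}` of connected components*: compatible (pairwise non-touching for `GeomInc R`) finite
families of `R`-connected nonempty cube sets (p. 268: *"We divide Λ₁₃^{(−1)c} into connected components {X_ω}"*).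
[cite: BalabanImbrieJaffe1988, (3.20) p.268] -/
noncomputable def gases : Finset (Finset (Finset κ)) := by
  classical
  exact (((univ : Finset κ).powerset.filter fun X => IsRConnected R X).powerset.filter
    (fun 𝒢 => IsCompatible (GeomInc R) 𝒢))

variable {R}

/-- Membership in `gases`. [cite: BalabanImbrieJaffe1988, (3.20) p.268] -/
theorem mem_gases {𝒢 : Finset (Finset κ)} :
    𝒢 ∈ gases R ↔ (∀ X ∈ 𝒢, IsRConnected R X) ∧ IsCompatible (GeomInc R) 𝒢 := by
  classical
  unfold gases
  simp only [mem_filter, mem_powerset, subset_iff, mem_univ, true_and, implies_true]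

/-- The components of any cube set form such a family (tree: `isRConnected_rcomponent`, `isCompatible_rcomponents`).
[cite: BalabanImbrieJaffe1988, (3.20) p.268] -/
theorem rcomponents_mem_gases (hR : ∀ x y, R x y → R y x) (Q : Finset κ) : rcomponents R Q ∈ gases R := by
  refine mem_gases.2 ⟨fun X hX => ?_, isCompatible_rcomponents hR Q⟩
  obtain ⟨p, hp, rfl⟩ := mem_rcomponents_iff.1 hX
  exact isRConnected_rcomponent hR hp

/-- Distinct members of a family of components are disjoint (they do not even touch). [cite: BalabanImbrieJaffe1988, (3.20) p.268] -/
theorem disjoint_of_mem_gases {𝒢 : Finset (Finset κ)} (h𝒢 : 𝒢 ∈ gases R) {X Y : Finset κ} (hX : X ∈ 𝒢) (hY : Y ∈ 𝒢)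
    (hXY : X ≠ Y) : Disjoint X Y := by
  rw [Finset.disjoint_left]
  intro c hcX hcY
  exact (mem_gases.1 h𝒢).2 (mem_coe.2 hX) (mem_coe.2 hY) hXY (Or.inr ⟨c, hcX, c, hcY, Or.inl rfl⟩)

/-- … as a `PairwiseDisjoint` statement. [cite: BalabanImbrieJaffe1988, (3.20) p.268] -/
theorem pairwiseDisjoint_of_mem_gases {𝒢 : Finset (Finset κ)} (h𝒢 : 𝒢 ∈ gases R) :
    (𝒢 : Set (Finset κ)).PairwiseDisjoint id :=
  fun _ hX _ hY hXY => disjoint_of_mem_gases h𝒢 (mem_coe.1 hX) (mem_coe.1 hY) hXY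

/-- **Regions ↔ families of components.** A sum over all cube sets `Q` (the possible regions `Λ₁₃^{(−1)c}`) is the sum over all
families `{X_ω}` of connected components, `Q = ⋃_ω X_ω` (bijection `Q ↦ rcomponents R Q`, inverse `⋃`; tree:
`rcomponents_biUnion_eq`, `biUnion_rcomponents`). [cite: BalabanImbrieJaffe1988, (3.20) p.268] -/
theorem sum_powerset_univ_eq_sum_gases {M : Type*} [AddCommMonoid M] (hR : ∀ x y, R x y → R y x) (Φ : Finset κ → M) :
    ∑ Q ∈ (univ : Finset κ).powerset, Φ Q = ∑ 𝒢 ∈ gases R, Φ (𝒢.biUnion id) := by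
  symm
  refine Finset.sum_nbij' (fun 𝒢 => 𝒢.biUnion id) (fun Q => rcomponents R Q) ?_ ?_ ?_ ?_ ?_
  · intro 𝒢 _
    exact mem_powerset.2 (subset_univ _)
  · intro Q _
    exact rcomponents_mem_gases hR Q
  · intro 𝒢 h𝒢
    have h := mem_gases.1 (mem_coe.1 h𝒢)
    exact rcomponents_biUnion_eq h.1 h.2
  · intro Q _
    exact biUnion_rcomponents Q
  · intro 𝒢 _
    rfl

/-- The same re-indexing for the regions containing a fixed cube set `D` (the cover of `Λ₀^{(0)c}`).
[cite: BalabanImbrieJaffe1988, (3.20) p.268] -/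
theorem sum_powerset_univ_filter_eq_sum_gases {M : Type*} [AddCommMonoid M] (hR : ∀ x y, R x y → R y x)
    (D : Finset κ) (Φ : Finset κ → M) :
    ∑ Q ∈ (univ : Finset κ).powerset.filter (fun Q => D ⊆ Q), Φ Q =
      ∑ 𝒢 ∈ (gases R).filter (fun 𝒢 => D ⊆ 𝒢.biUnion id), Φ (𝒢.biUnion id) := by
  rw [sum_filter, sum_filter]
  exact sum_powerset_univ_eq_sum_gases hR fun Q => if D ⊆ Q then Φ Q else 0

/-- A product over a cube set is the product over its connected components of the products over the components (used for
*"The remaining r(e₀)-cubes … are divided into connected components {X_σ}"*, (3.21)). [cite: BalabanImbrieJaffe1988, (3.21) p.268] -/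
theorem prod_eq_prod_rcomponents {M : Type*} [CommMonoid M] (hR : ∀ x y, R x y → R y x) (Q : Finset κ) (f : κ → M) :
    ∏ c ∈ Q, f c = ∏ Y ∈ rcomponents R Q, ∏ c ∈ Y, f c := by
  conv_lhs => rw [← biUnion_rcomponents (R := R) Q]
  rw [prod_biUnion]
  · rfl
  · exact pairwiseDisjoint_of_mem_gases (rcomponents_mem_gases hR Q)

end Gases


/-! ## The weights of one term and the activity `g(X)` of a connected region -/

section Weights

variable {κ E M : Type*} [DecidableEq κ] [DecidableEq E] [CommRing M]
variable (items : Finset E) (home : E → κ) (w₁ w₀ : E → M)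

/-- The weight of an expansion set `S` relative to a universe `E'` of expandable factors: selected factors carry `w₁`
(`F_irr(p)`, `e^{−W₀(p)} − 1`), unselected ones `w₀` (`F_rel(p)`, `1`) — one term of (3.18)×(3.19). [cite: BalabanImbrieJaffe1988, (3.20) p.268] -/
def wt (E' S : Finset E) : M := (∏ e ∈ S, w₁ e) * ∏ e ∈ E' \ S, w₀ e

/-- The expandable factors homed in a cube set `X` (p. 268: *"S_π ⊂ π(F)∩Λ₀^{(0)**}∩X_ω^{**}"*, *"S_p ⊂ Λ₀^{(0)**}∩X_ω^{**}"*, membership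
read through the home cube). [cite: BalabanImbrieJaffe1988, (3.20) p.268] -/
def itemsIn (X : Finset κ) : Finset E := items.filter fun e => home e ∈ X

/-- **(3.20), the activity `g₀(X)` of a connected region**, with the implicit constraint explicit: the sum over the expansion sets
`S_X` homed in `X` which together with `D ∩ X` (the large-field cubes inside `X`) GENERATE `X` — `(D ∩ X) ∪ home(S_X) = X` — of the
weight of `S_X` times the cube factors `Π_{c∈X} k c` (the exponential and the unexpanded factors of (3.20)). Reading note GAPS
G-C2-09. [cite: BalabanImbrieJaffe1988, (3.20) p.268] -/
def gfun (D : Finset κ) (k : κ → M) (X : Finset κ) : M :=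
  ∑ S ∈ (itemsIn items home X).powerset.filter (fun S => D ∩ X ∪ S.image home = X),
    wt w₁ w₀ (itemsIn items home X) S * ∏ c ∈ X, k c

variable {items home w₁ w₀}

omit [DecidableEq E] in
/-- Membership in `itemsIn`. [cite: BalabanImbrieJaffe1988, (3.20) p.268] -/
theorem mem_itemsIn {X : Finset κ} {e : E} : e ∈ itemsIn items home X ↔ e ∈ items ∧ home e ∈ X := by
  simp [itemsIn]

omit [DecidableEq E] in
/-- `itemsIn X ⊆ items`. [cite: BalabanImbrieJaffe1988, (3.20) p.268] -/
theorem itemsIn_subset (X : Finset κ) : itemsIn items home X ⊆ items := filter_subset _ _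

/-- Items homed in a union. [cite: BalabanImbrieJaffe1988, (3.20) p.268] -/
theorem itemsIn_union (X Y : Finset κ) : itemsIn items home (X ∪ Y) = itemsIn items home X ∪ itemsIn items home Y := by
  ext e; simp only [mem_itemsIn, mem_union]; tauto

omit [DecidableEq E] in
/-- Disjoint regions have disjoint item sets. [cite: BalabanImbrieJaffe1988, (3.20) p.268] -/
theorem disjoint_itemsIn {X Y : Finset κ} (h : Disjoint X Y) : Disjoint (itemsIn items home X) (itemsIn items home Y) := by
  rw [Finset.disjoint_left] at h ⊢
  intro e heX heY
  exact h (mem_itemsIn.1 heX).2 (mem_itemsIn.1 heY).2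

omit [DecidableEq E] in
/-- Items homed in `X` generate cubes of `X` only. [cite: BalabanImbrieJaffe1988, (3.20) p.268] -/
theorem image_home_subset {X : Finset κ} {S : Finset E} (hS : S ⊆ itemsIn items home X) : S.image home ⊆ X := by
  intro c hc
  obtain ⟨e, he, rfl⟩ := mem_image.1 hc
  exact (mem_itemsIn.1 (hS he)).2

/-- The weight is multiplicative over disjoint universes. [cite: BalabanImbrieJaffe1988, (3.20) p.268] -/
theorem wt_union {E₁ E₂ S₁ S₂ : Finset E} (hE : Disjoint E₁ E₂) (h₁ : S₁ ⊆ E₁) (h₂ : S₂ ⊆ E₂) :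
    wt w₁ w₀ (E₁ ∪ E₂) (S₁ ∪ S₂) = wt w₁ w₀ E₁ S₁ * wt w₁ w₀ E₂ S₂ := by
  unfold wt
  have hS : Disjoint S₁ S₂ := hE.mono h₁ h₂
  have hsd : (E₁ ∪ E₂) \ (S₁ ∪ S₂) = (E₁ \ S₁) ∪ (E₂ \ S₂) := by
    ext e
    simp only [mem_sdiff, mem_union, not_or]
    constructor
    · rintro ⟨h | h, hn1, hn2⟩
      · exact Or.inl ⟨h, hn1⟩
      · exact Or.inr ⟨h, hn2⟩
    · rintro (⟨h, hn⟩ | ⟨h, hn⟩)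
      · exact ⟨Or.inl h, hn, fun he => Finset.disjoint_left.1 hE h (h₂ he)⟩
      · exact ⟨Or.inr h, fun he => Finset.disjoint_left.1 hE (h₁ he) h, hn⟩
  have hsdj : Disjoint (E₁ \ S₁) (E₂ \ S₂) := hE.mono sdiff_subset sdiff_subset
  rw [hsd, prod_union hS, prod_union hsdj]
  ring

/-- Bookkeeping: inside disjoint regions `X`, `U`, parts `P₁ ⊆ X`, `P₂ ⊆ U` fill `X ∪ U` iff each fills its region.
[cite: BalabanImbrieJaffe1988, (3.20) p.268] -/
theorem union_eq_union_iff_of_disjoint {X U P₁ P₂ : Finset κ} (hXU : Disjoint X U) (h₁ : P₁ ⊆ X) (h₂ : P₂ ⊆ U) :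
    P₁ ∪ P₂ = X ∪ U ↔ P₁ = X ∧ P₂ = U := by
  constructor
  · intro h
    constructor
    · refine Subset.antisymm h₁ fun c hc => ?_
      have : c ∈ P₁ ∪ P₂ := h ▸ mem_union_left U hc
      rcases mem_union.1 this with h' | h'
      · exact h'
      · exact absurd (h₂ h') (Finset.disjoint_left.1 hXU hc)
    · refine Subset.antisymm h₂ fun c hc => ?_
      have : c ∈ P₁ ∪ P₂ := h ▸ mem_union_right X hc
      rcases mem_union.1 this with h' | h'
      · exact absurd hc (Finset.disjoint_left.1 hXU (h₁ h'))
      · exact h'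
  · rintro ⟨rfl, rfl⟩; rfl

/-- plumbing: an indicator of a conjunction times a product. [folklore] -/
private theorem ite_and_mul_zero (p q : Prop) [Decidable p] [Decidable q] (a b : M) :
    (if p ∧ q then a * b else 0) = (if p then a else 0) * (if q then b else 0) := by
  split_ifs <;> simp_all

/-- **Factorisation over the components.** For a family `𝒢` of pairwise DISJOINT regions with union `U`, the constrained sum over
the expansion sets homed in `U` that (with `D ∩ U`) generate `U`, of weight × cube factors, is the product over `X ∈ 𝒢` of the
activities `gfun X`: *"Π_ω g₀(X_ω)"*. [cite: BalabanImbrieJaffe1988, (3.20) p.268] -/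
theorem fiber_sum_eq_prod_gfun (D : Finset κ) (k : κ → M) (𝒢 : Finset (Finset κ))
    (hdisj : (𝒢 : Set (Finset κ)).PairwiseDisjoint id) :
    ∑ S ∈ (itemsIn items home (𝒢.biUnion id)).powerset.filter
        (fun S => D ∩ 𝒢.biUnion id ∪ S.image home = 𝒢.biUnion id),
      wt w₁ w₀ (itemsIn items home (𝒢.biUnion id)) S * ∏ c ∈ 𝒢.biUnion id, k c =
      ∏ X ∈ 𝒢, gfun items home w₁ w₀ D k X := by
  induction 𝒢 using Finset.induction_on with
  | empty =>
    rw [prod_empty]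
    have h0 : itemsIn items home ((∅ : Finset (Finset κ)).biUnion id) = ∅ := by
      ext e; simp [mem_itemsIn]
    rw [h0, biUnion_empty]
    simp [wt, Finset.filter_singleton]
  | insert X 𝒢' hX ih =>
    have hdisj' : (𝒢' : Set (Finset κ)).PairwiseDisjoint id := hdisj.subset (by simp)
    have hXU : Disjoint X (𝒢'.biUnion id) := by
      rw [disjoint_biUnion_right]
      intro Y hY
      have hXY : X ≠ Y := fun h => hX (h ▸ hY)
      exact hdisj (mem_coe.2 (mem_insert_self X 𝒢')) (mem_coe.2 (mem_insert_of_mem hY)) hXY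
    set U := 𝒢'.biUnion id with hU
    rw [prod_insert hX, ← ih hdisj', biUnion_insert, id, ← hU, itemsIn_union, sum_filter,
      sum_powerset_union_of_disjoint (disjoint_itemsIn hXU), gfun, sum_filter, sum_filter, sum_mul_sum]
    refine sum_congr rfl fun S₁ hS₁ => sum_congr rfl fun S₂ hS₂ => ?_
    rw [mem_powerset] at hS₁ hS₂
    rw [← ite_and_mul_zero]
    have hcond : D ∩ (X ∪ U) ∪ (S₁ ∪ S₂).image home = X ∪ U ↔
        D ∩ X ∪ S₁.image home = X ∧ D ∩ U ∪ S₂.image home = U := by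
      have hre : D ∩ (X ∪ U) ∪ (S₁ ∪ S₂).image home = (D ∩ X ∪ S₁.image home) ∪ (D ∩ U ∪ S₂.image home) := by
        rw [inter_union_distrib_left, image_union]
        ext c; simp only [mem_union]; tauto
      rw [hre]
      exact union_eq_union_iff_of_disjoint hXU (union_subset inter_subset_right (image_home_subset hS₁))
        (union_subset inter_subset_right (image_home_subset hS₂))
    have hval : wt w₁ w₀ (itemsIn items home X ∪ itemsIn items home U) (S₁ ∪ S₂) * ∏ c ∈ X ∪ U, k c =
        (wt w₁ w₀ (itemsIn items home X) S₁ * ∏ c ∈ X, k c) * (wt w₁ w₀ (itemsIn items home U) S₂ * ∏ c ∈ U, k c) := by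
      rw [wt_union (disjoint_itemsIn hXU) hS₁ hS₂, prod_union hXU]
      ring
    rw [hval]
    exact if_congr hcond rfl rfl

end Weights


/-! ## The resummation identity -/

section Main

variable {κ E M : Type*} [DecidableEq κ] [Fintype κ] [DecidableEq E] [CommRing M]
variable {R : κ → κ → Prop} {items : Finset E} {home : E → κ} {w₁ w₀ : E → M}

/-- The region generated by an expansion set: p. 268 *"Λ₁₃^{(−1)c} … the union of r(e₀)-cubes covering Λ₀^{(0)c} and all plaquettes
in S_p or S_π"* — `D ∪ home(S)`. [cite: BalabanImbrieJaffe1988, (3.20) p.268] -/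
def region (D : Finset κ) (home : E → κ) (S : Finset E) : Finset κ := D ∪ S.image home

omit [Fintype κ] [DecidableEq E] in
/-- The region contains the large-field cubes `D`. [cite: BalabanImbrieJaffe1988, (3.20) p.268] -/
theorem subset_region (D : Finset κ) (home : E → κ) (S : Finset E) : D ⊆ region D home S := subset_union_left

omit [Fintype κ] [DecidableEq E] in
/-- The expansion sets generating a given region `Q ⊇ D` are sets of items homed in `Q`. [cite: BalabanImbrieJaffe1988, (3.20) p.268] -/
theorem filter_region_eq (D Q : Finset κ) (hDQ : D ⊆ Q) :
    items.powerset.filter (fun S => region D home S = Q) =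
      (itemsIn items home Q).powerset.filter (fun S => D ∩ Q ∪ S.image home = Q) := by
  have hD : D ∩ Q = D := inter_eq_left.2 hDQ
  ext S
  simp only [mem_filter, mem_powerset, region, hD]
  constructor
  · rintro ⟨hS, hreg⟩
    refine ⟨fun e he => mem_itemsIn.2 ⟨hS he, ?_⟩, hreg⟩
    rw [← hreg]
    exact mem_union_right D (mem_image_of_mem home he)
  · rintro ⟨hS, hreg⟩
    exact ⟨hS.trans (itemsIn_subset Q), hreg⟩

omit [Fintype κ] in
/-- For an expansion set homed in `Q`, the unselected factors homed outside `Q` split off the weight.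
[cite: BalabanImbrieJaffe1988, (3.21) p.268] -/
theorem wt_items_eq (Q : Finset κ) {S : Finset E} (hS : S ⊆ itemsIn items home Q) :
    wt w₁ w₀ items S = wt w₁ w₀ (itemsIn items home Q) S * ∏ e ∈ items.filter (fun e => home e ∉ Q), w₀ e := by
  unfold wt
  have hsplit : items \ S = (itemsIn items home Q \ S) ∪ items.filter (fun e => home e ∉ Q) := by
    ext e
    simp only [mem_sdiff, mem_union, mem_filter, mem_itemsIn]
    constructor
    · rintro ⟨he, heS⟩
      by_cases hQ : home e ∈ Q
      · exact Or.inl ⟨⟨he, hQ⟩, heS⟩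
      · exact Or.inr ⟨he, hQ⟩
    · rintro (⟨⟨he, -⟩, heS⟩ | ⟨he, hQ⟩)
      · exact ⟨he, heS⟩
      · exact ⟨he, fun heS => hQ (mem_itemsIn.1 (hS heS)).2⟩
  have hdj : Disjoint (itemsIn items home Q \ S) (items.filter (fun e => home e ∉ Q)) := by
    rw [Finset.disjoint_left]
    intro e he he'
    exact (mem_filter.1 he').2 (mem_itemsIn.1 (mem_sdiff.1 he).1).2
  rw [hsplit, prod_union hdj, mul_assoc]

omit [DecidableEq E] in
/-- The factors outside the region, cube by cube: `Π_{c∉Q} h c · Π_{home e ∉ Q} w₀ e = Π_{c∉Q} (h c · Π_{home e = c} w₀ e)` (the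
factors of `F_{0,loc}`, (3.21)). [cite: BalabanImbrieJaffe1988, (3.21) p.268] -/
theorem prod_compl_mul_prod_filter (Q : Finset κ) (h : κ → M) :
    (∏ c ∈ Qᶜ, h c) * ∏ e ∈ items.filter (fun e => home e ∉ Q), w₀ e =
      ∏ c ∈ Qᶜ, (h c * ∏ e ∈ items.filter (fun e => home e = c), w₀ e) := by
  rw [prod_mul_distrib]
  congr 1
  rw [← prod_fiberwise_of_maps_to (s := items.filter (fun e => home e ∉ Q)) (t := Qᶜ) (g := home)
    (fun e he => mem_compl.2 (mem_filter.1 he).2)]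
  refine prod_congr rfl fun c hc => ?_
  rw [filter_filter]
  refine prod_congr ?_ fun _ _ => rfl
  ext e
  simp only [mem_filter]
  constructor
  · rintro ⟨he, -, hec⟩; exact ⟨he, hec⟩
  · rintro ⟨he, hec⟩; exact ⟨he, hec ▸ mem_compl.1 hc, hec⟩

/-- **THE REGROUPING IDENTITY of (3.20)–(3.22)**, p. 268 [PDF 12]: the sum over all expansion sets `S ⊆ items` (= `S_π ⊔ S_p` of
(3.18)–(3.19)) of `weight(S) × Π_{cubes of the generated region} k × Π_{other cubes} h` EQUALS the sum over all families `{X_ω}`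
of pairwise non-touching connected cube sets whose union contains `D` (the cover of `Λ₀^{(0)c}`) of `Π_ω g(X_ω)` (the activities
(3.20), with the generating constraint) times the product over the cubes outside `⋃X_ω` of `h c` and the unselected factors
homed there (the factors of the `F_{0,loc}(X_σ)`, (3.21)): *"Σ_{S_π} Σ_{S_p} … = Σ_{{X_ω}} Π_ω g₀(X_ω) Π_σ F_{0,loc}(X_σ) …"*.
Every commutative ring; `R` symmetric. [cite: BalabanImbrieJaffe1988, (3.22) p.268] -/
theorem resum320 (hR : ∀ x y, R x y → R y x) (items : Finset E) (home : E → κ) (w₁ w₀ : E → M) (D : Finset κ)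
    (k h : κ → M) :
    ∑ S ∈ items.powerset,
        wt w₁ w₀ items S * ((∏ c ∈ region D home S, k c) * ∏ c ∈ (region D home S)ᶜ, h c) =
      ∑ 𝒢 ∈ (gases R).filter (fun 𝒢 => D ⊆ 𝒢.biUnion id),
        (∏ X ∈ 𝒢, gfun items home w₁ w₀ D k X) *
          ∏ c ∈ (𝒢.biUnion id)ᶜ, (h c * ∏ e ∈ items.filter (fun e => home e = c), w₀ e) := by
  -- step 1: sum fiberwise over the region
  rw [← sum_fiberwise_of_maps_to (s := items.powerset) (t := (univ : Finset κ).powerset) (g := region D home)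
    (fun S _ => mem_powerset.2 (subset_univ _))]
  -- step 2/3: inside a fiber the cube factors are constant; fibers over `Q ⊉ D` are empty
  have hfib : ∀ Q : Finset κ,
      ∑ S ∈ items.powerset.filter (fun S => region D home S = Q),
          wt w₁ w₀ items S * ((∏ c ∈ region D home S, k c) * ∏ c ∈ (region D home S)ᶜ, h c) =
        if D ⊆ Q then ((∏ c ∈ Q, k c) * ∏ c ∈ Qᶜ, (h c * ∏ e ∈ items.filter (fun e => home e = c), w₀ e)) *
          ∑ S ∈ (itemsIn items home Q).powerset.filter (fun S => D ∩ Q ∪ S.image home = Q),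
            wt w₁ w₀ (itemsIn items home Q) S else 0 := by
    intro Q
    split_ifs with hDQ
    · rw [filter_region_eq D Q hDQ, mul_sum]
      refine sum_congr rfl fun S hS => ?_
      obtain ⟨hSQ, hreg⟩ := mem_filter.1 hS
      rw [mem_powerset] at hSQ
      have hreg' : region D home S = Q := by
        rw [region, ← inter_eq_left.2 hDQ]; exact hreg
      rw [hreg', wt_items_eq Q hSQ, ← prod_compl_mul_prod_filter Q h]
      ring
    · refine sum_eq_zero fun S hS => ?_
      exact absurd ((subset_region D home S).trans (mem_filter.1 hS).2.le) hDQ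
  simp_rw [hfib]
  rw [← sum_filter, sum_powerset_univ_filter_eq_sum_gases hR D]
  refine sum_congr rfl fun 𝒢 h𝒢 => ?_
  have hgas : 𝒢 ∈ gases R := (mem_filter.1 h𝒢).1
  rw [← fiber_sum_eq_prod_gfun D k 𝒢 (pairwiseDisjoint_of_mem_gases hgas), mul_sum, sum_mul]
  refine sum_congr rfl fun S _ => ?_
  ring

/-- **(3.22) form, with the `{X_σ}`**: the same identity with the factors outside `⋃X_ω` grouped into the connected components
`{X_σ}` of the complement — *"The remaining r(e₀)-cubes … are divided into connected components {X_σ}, and we put F_{0,loc}(X_σ) =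
…"* — i.e. `Σ_S … = Σ_{{X_ω}} Π_ω g(X_ω) · Π_σ [Π_{c∈X_σ} (h c · Π_{home e = c} w₀ e)]`. [cite: BalabanImbrieJaffe1988, (3.22) p.268] -/
theorem resum320_components (hR : ∀ x y, R x y → R y x) (items : Finset E) (home : E → κ) (w₁ w₀ : E → M) (D : Finset κ)
    (k h : κ → M) :
    ∑ S ∈ items.powerset,
        wt w₁ w₀ items S * ((∏ c ∈ region D home S, k c) * ∏ c ∈ (region D home S)ᶜ, h c) =
      ∑ 𝒢 ∈ (gases R).filter (fun 𝒢 => D ⊆ 𝒢.biUnion id),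
        (∏ X ∈ 𝒢, gfun items home w₁ w₀ D k X) *
          ∏ Y ∈ rcomponents R (𝒢.biUnion id)ᶜ, ∏ c ∈ Y, (h c * ∏ e ∈ items.filter (fun e => home e = c), w₀ e) := by
  rw [resum320 hR]
  refine sum_congr rfl fun 𝒢 _ => ?_
  rw [prod_eq_prod_rcomponents hR]

/-- Sanity check (the identity is a regrouping, not an estimate): with equal cube factors inside and outside, `k = h`, the left
side of `resum320` is just `Π_{e ∈ items} (w₁ e + w₀ e) · Π_c k c` — the fully expanded product, cf. (3.18)–(3.19) read backwards.
[cite: BalabanImbrieJaffe1988, (3.19) p.268] -/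
theorem sum_wt_mul_eq (items : Finset E) (home : E → κ) (w₁ w₀ : E → M) (D : Finset κ) (k : κ → M) :
    ∑ S ∈ items.powerset, wt w₁ w₀ items S * ((∏ c ∈ region D home S, k c) * ∏ c ∈ (region D home S)ᶜ, k c) =
      (∏ e ∈ items, (w₁ e + w₀ e)) * ∏ c, k c := by
  have hk : ∀ S : Finset E, (∏ c ∈ region D home S, k c) * ∏ c ∈ (region D home S)ᶜ, k c = ∏ c, k c := fun S =>
    prod_mul_prod_compl _ _
  simp_rw [hk, ← sum_mul]
  congr 1
  rw [prod_add]
  refine sum_congr rfl fun S hS => ?_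
  rw [wt]

end Main

end Literature.MathematicalPhysics.QuantumFieldTheory.BalabanImbrieJaffe1984to88.BIJ88ComponentResum320
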